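/-
Copyright (c) 2026 the pub-hodgecm-mathlib formalisation cell (harness21).  Prover seat hodgecm-mathlib-K2E3-p24 (g2), HCML Track B «K2-LIT» ∕ h413 (`stmt-HodgeConjecture-24833`),
line «SC′-IRR-lev» (lead K2E3-p24, dealer D82): ASM of the leaf (S-C′-irr) `sig_K2E3GL3TwoBlockInducedIrreducible` (U12 :491) — `ρ × χ` and `χ × ρ` are irreducible.  2026-09-04.
-/
import Summits.HodgeConjecture.HodgeConjecture.Theorems.K2E3GL3TwoBlockInducedIrreducibleCore   -- ASM core (this seat): `ρ × χ` irreducible modulo the `Q'`-letter; brings JM-A, BLK, DEG, GEN-COUNT, PSI-EX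
import Summits.HodgeConjecture.HodgeConjecture.Theorems.K2E3GL3CuspidalBlockJacquetCross        -- ★ JM-B (K2E5-p17): `r_{Q'}(i_Q σ')` irreducible
import Summits.HodgeConjecture.HodgeConjecture.Theorems.K2E3GL3OuterAutomorphismInduction       -- ★ T1 (K2E3-p21): `P₍₁,₂₎` from `P₍₂,₁₎` by `g ↦ w₀ ᵗg⁻¹ w₀`
import Summits.HodgeConjecture.HodgeConjecture.Theorems.K2E3LocalFieldAddCharExists              -- ★ PSI-EX (K2E3-p24 g0): a continuous non-trivial `ψ` exists
import Literature.NumberTheory.Automorphic.WhittakerInducedMultiplicity                         -- ★ WH-1 `rank_whittakerFunctionals_parabolicIndGL_le_one_of_fact`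
import Literature.NumberTheory.Automorphic.WhittakerModelsRankLeOneHolds                        -- ★ local multiplicity one `rank_whittakerFunctionals_le_one_holds`
import Literature.NumberTheory.Automorphic.MatrixCoefficientsSupercuspidalAdmissibleProofs      -- ★ `IsSupercuspidal.isAdmissible_of_sigmaCompactSpace`
import Literature.NumberTheory.Automorphic.PAdicRepsJacquetAdmissibilityProofs                  -- ★ `sigmaCompactSpace_levi`
import HarnessLib

/-!
# K2_E3 road (h413), line «SC′-IRR-lev», ASM — LEAF (S-C′-irr) `sig_K2E3GL3TwoBlockInducedIrreducible`: for `σ` irreducible smooth supercuspidal on a maximal Levi of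
# `GL₃(F)`, `i_{P_c} σ` is IRREDUCIBLE ([Zelevinsky1980, Thm. 4.2]: `ρ × χ` and `χ × ρ` are irreducible)

Cell `pub/hodgecm-mathlib` (D-0151), Track B, seat K2E3-p24 (g2) = LEAD of line «SC′-IRR-lev» (dealer K2E3-plan D82; hands BLK K2E3-p21 (g6) D83, JM-B K2E5-p17 (g6) D84,
DEG K2E3-p23 (g6) D85, T1 K2E3-p21 (g6) D81, LEV-3 K2E3-p17 (g8) D76, GEN-COUNT∕PSI-EX K2E3-p24 (g0)).  `--supports stmt-HodgeConjecture-24833 --as helper`; THEOREMS ONLY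
(no definition ∕ instance ∕ notation ∕ named fact ∕ `sorry`); never imports `Cruxes/…/Lines`.  COUNT-NEUTRAL until the dealer ties the leaf BY NAME: `twoBlockInducedIrreducible`
has the type of `sig_K2E3GL3TwoBlockInducedIrreducible` (U12 :491) VERBATIM.

THE MATHEMATICS.  ★ core `K2E3GL3TwoBlockInducedIrreducibleCore.isIrreducible_parabolicIndGL_twoOne_of_jacquet` proves `i_Q σ` irreducible (`Q = P₍₂,₁₎`, `σ` irreducible
smooth supercuspidal on `GL₂ × GL₁`) from the irreducibility of `r_{Q'}(i_Q σ)`; ★ JM-B `isIrreducible_jacquetGL_oneTwo` supplies it over the ★ BLK letters `W = W(X₀₁)` and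
Levi-irreducibility (`w₀ M' w₀⁻¹ = M`); ★ T1 transports to `Q' = P₍₁,₂₎` along `g ↦ w₀ ᵗg⁻¹ w₀`; a monotone surjective `c : Fin 3 → Fin 2` is `![0,0,1]` or `![0,1,1]` (core §1).

HONEST LABEL: HC_CM is proved only modulo the 7 printed citations (2 remaining named inputs: hLiu418 = stmt-HodgeConjecture-24832, h413 = stmt-HodgeConjecture-24833)
until rung 0 closes; count-neutral until the U12 tie.

## Mathlib ∕ tree search
Tree (★, by name): core `isIrreducible_parabolicIndGL_twoOne_of_jacquet`, `eq_twoOne_or_eq_oneTwo`; JM-B `isIrreducible_jacquetGL_oneTwo`; BLK `mem_span_twist_transvection_zero_one_sub`,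
`forall_submodule_eq_bot_or_top_of_leviStable_rev`; `IsSmooth.twist_comp_leviProjection`; T1 `isIrreducible_parabolicIndGL_one_two_of_two_one`.
Dedup: `rg "twoBlockInducedIrreducible"` — only the U12 `sig_` and g0's consumers (hypothesis `hIrr`).

## References
* [Zelevinsky1980] A. V. Zelevinsky, *Induced representations of reductive 𝔭-adic groups II*, Ann. Sci. ÉNS (4) 13 (1980), 165–210, Thm. 4.2 p. 184.
* [BernsteinZelevinsky1977] I. N. Bernstein, A. V. Zelevinsky, *Induced representations of reductive 𝔭-adic groups I*, Ann. Sci. ÉNS 10 (1977), Thm. 4.2, §2.12–2.14.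
-/

set_option autoImplicit false
set_option linter.dupNamespace false

noncomputable section

namespace Summit.HodgeConjecture.HodgeConjecture.Cruxes.H413.K2E3GL3TwoBlockInducedIrreducible

open Literature.NumberTheory.Automorphic Representation K2E3GL3MaximalParabolicRelabel K2E3GL3TwoBlockInducedIrreducibleCore

universe u

section Assembly

variable {F : Type u} [Field F] [ValuativeRel F] [TopologicalSpace F] [IsNonarchimedeanLocalField F]
  {W : Type u} [AddCommGroup W] [Module ℂ W]
  (σ : Representation ℂ (Π a, GL {i // (![0, 0, 1] : Fin 3 → Fin 2) i = a} F) W)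

/-- **`ρ × χ` IS IRREDUCIBLE** (`Q = P₍₂,₁₎`): for `σ` irreducible smooth supercuspidal on `GL₂(F) × GL₁(F)`, `i_Q σ` is irreducible — §4 head with the `Q'`-letter paid by ★ JM-B
`isIrreducible_jacquetGL_oneTwo` over the ★ BLK letters. [cite: Zelevinsky1980, Thm. 4.2 p. 184] [cite: BernsteinZelevinsky1977, Thm. 4.2] -/
theorem isIrreducible_parabolicIndGL_twoOne [σ.IsIrreducible] (hσ : σ.IsSmooth) (hsc : σ.IsSupercuspidal) :
    (parabolicIndGL F (![0, 0, 1] : Fin 3 → Fin 2) σ).IsIrreducible := by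
  haveI : Nontrivial W := IsIrreducible.nontrivial σ
  haveI : SigmaCompactSpace (Π a, GL {i // (![0, 0, 1] : Fin 3 → Fin 2) i = a} F) := sigmaCompactSpace_levi F _
  have hadm : σ.IsAdmissible := IsSupercuspidal.isAdmissible_of_sigmaCompactSpace hσ hsc
  obtain ⟨ψ, hψ⟩ := K2E3LocalFieldAddCharExists.exists_addChar_isContinuousNontrivial F
  have hrank : Module.rank ℂ ↥(whittakerFunctionals (parabolicIndGL F (![0, 0, 1] : Fin 3 → Fin 2) σ) ψ) ≤ 1 :=
    rank_whittakerFunctionals_parabolicIndGL_le_one_of_fact (![0, 0, 1] : Fin 3 → Fin 2) ψ σ monotone_twoOne hψ hadm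
      fun m _ _ V _ _ ρ => rank_whittakerFunctionals_le_one_holds ρ ψ
  refine isIrreducible_parabolicIndGL_twoOne_of_jacquet σ hσ hsc hψ hrank ?_
  exact K2E3GL3CuspidalBlockJacquetCross.isIrreducible_jacquetGL_oneTwo _ (hσ.twist_comp_leviProjection F _)
    (K2E3GL3CuspidalBlockRestriction.mem_span_twist_transvection_zero_one_sub F σ hσ hsc)
    (K2E3GL3CuspidalBlockRestriction.forall_submodule_eq_bot_or_top_of_leviStable_rev F σ)

end Assembly

/-! ## §5  The leaf -/

/-- **LEAF (S-C′-irr) «`ρ × χ` AND `χ × ρ` ARE IRREDUCIBLE»** [Zelevinsky1980, Thm. 4.2]: for `F` a non-archimedean local field (characteristic `0`), a maximal standard parabolic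
`P_c` of `GL₃(F)` (`c : Fin 3 → Fin 2` monotone surjective: `P₍₂,₁₎` or `P₍₁,₂₎`) and an irreducible smooth SUPERCUSPIDAL representation `σ` of its block Levi
`GL₂(F) × GL₁(F)` ∕ `GL₁(F) × GL₂(F)` (on `W : Type`), the normalised parabolic induction `parabolicIndGL F c σ` is IRREDUCIBLE.  Statement = `sig_K2E3GL3TwoBlockInducedIrreducible`
(U12 :491) VERBATIM; `c = ![0,0,1]` is `isIrreducible_parabolicIndGL_twoOne`, `c = ![0,1,1]` follows by ★ T1. [cite: Zelevinsky1980, Thm. 4.2 p. 184] [cite: BernsteinZelevinsky1977, Thm. 4.2] -/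
theorem twoBlockInducedIrreducible :
    ∀ (F : Type) [Field F] [ValuativeRel F] [TopologicalSpace F] [IsNonarchimedeanLocalField F] [CharZero F]
      (c : Fin 3 → Fin 2), Monotone c → Function.Surjective c →
      ∀ (W : Type) [AddCommGroup W] [Module ℂ W] (σ : Representation ℂ (Π a, GL {i // c i = a} F) W),
        σ.IsIrreducible → σ.IsSmooth → σ.IsSupercuspidal → (Representation.parabolicIndGL F c σ).IsIrreducible := by
  intro F _ _ _ _ _ c hc hcs W _ _ σ hσi hσs hσc
  rcases eq_twoOne_or_eq_oneTwo c hc hcs with rfl | rfl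
  · haveI := hσi
    exact isIrreducible_parabolicIndGL_twoOne σ hσs hσc
  · haveI := hσi
    exact K2E3GL3OuterAutomorphismInduction.isIrreducible_parabolicIndGL_one_two_of_two_one F
      (fun σ' hσ'i hσ's hσ'c => by haveI := hσ'i; exact isIrreducible_parabolicIndGL_twoOne σ' hσ's hσ'c) σ hσs hσc


end Summit.HodgeConjecture.HodgeConjecture.Cruxes.H413.K2E3GL3TwoBlockInducedIrreducible

end
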